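import Summits.RiemannHypothesis.RiemannHypothesis.Theses.LiHeightLog
import Summits.RiemannHypothesis.RiemannHypothesis.Theorems.LiHeightLogLiHeightBudgetLogBound
import HarnessLib

/-!
# RiemannHypothesis / LiHeightLog — closer of crux `LiHeightBudgetLog` (closed budget inequality; RH-FREE)

Route `RiemannHypothesis/LiHeightLog` (cell `pub/rh-li`, round 6), item `LiHeightBudgetLog`
(stmt-RiemannHypothesis-19649): the route decl BY NAME, from `liHeightBudgetLog_bound`
(`Theorems/LiHeightLogLiHeightBudgetLogBound.lean`).  RH-FREE PROOF-OF-DATA rung L-P(P1-log) of the RH ladder's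
column LI; nothing here bears on the truth of RH.
-/

noncomputable section

-- D-0017: `Summit.<S>.<S>.…` is the designed namespace of a single-problem summit.
set_option linter.dupNamespace false

namespace Summit.RiemannHypothesis.RiemannHypothesis.Theorems

/-- **Crux `LiHeightBudgetLog` of route `LiHeightLog` holds** (RH-FREE): for `T ≥ 1000` and
`900 ≤ n ≤ 2T² log T`, `2√n log n + liCoshDefect n T < liMainTerm n`. -/
theorem liHeightBudgetLog_proof :
    Summit.RiemannHypothesis.RiemannHypothesis.Theses.LiHeightLog.LiHeightBudgetLog := by
  unfold Summit.RiemannHypothesis.RiemannHypothesis.Theses.LiHeightLog.LiHeightBudgetLog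
  exact LiTheory.liHeightBudgetLog_bound

end Summit.RiemannHypothesis.RiemannHypothesis.Theorems

end
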